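import Summits.BirchSwinnertonDyer.BirchSwinnertonDyer.Theorems.AlignedTransportAtTwoMainConjectureOfRankZeroBSDAtTwoCubicRankDoorModelsAnyRung
import HarnessLib

/-!
# Route `AlignedTransportAtTwo`, crux C2 `MainConjectureOfRankZeroBSDAtTwo` (stmt-22298), line `birth` — THE RUNG-`0` ROWS ON MODELS FOR THE SMALL SEEDS
# (`1727a1`, `2071a1`, `4087a1`, `4087c1`; `2045b1` is in `…CubicRankDoorModelsAnyRung`): per seed, ONE quadratic extension `L' ∋ √2` of the cubic field `ℚ(β)` with
# `rank₂ Cl(L') = rank₂ Cl(ℚ(β))` (or `ord₂ #Cl(L') = ord₂ #Cl(ℚ(β))`) ⟹ `MC₂(seed)` — the census template of the cubic road at its cheapest rung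

HONEST FRAMING (cell `bsd-f1-sign2`, WIDTH-5 attach seat `bsd-line-att-p4` g26, route-ledger lane; `--supports stmt-BirchSwinnertonDyer-22298 --as helper`).
THEOREMS ONLY (no `def`, no named fact, no `sorry`, no instance). BSD is NOT proved; C2 is NOT closed; its verdict «blocked-on
`Rank1Residual.GreenbergMuConjectureIrreducible`» is untouched; every row is CONDITIONAL on PRINT⁵ {Kato 17.4 (1)(2) at `2`, Greenberg 4.1, period unit, modularity,
GZK} + Creutz–Miller (`N < 5000`) + the registered stub MuIneqʳ (verbatim) + the displayed seed datum `r_an = 0` + ONE displayed class-group certificate (a finite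
computation NOT performed here: -data CENSUS ASK). No new mathematics: this seat's uniform rung-`0` models doors
(`…CubicRankDoorModelsAnyRung.mazurMainConjecture_two_of_muIneqRel_of_classGroup_rungZero_models` / `…_of_classNumber_rungZero_models`, p761162) instantiated at
the small seeds of the twist-family partition (kernel facts `goodOrd_two_…`, `not_hasRationalTwoTorsionX_…`, `Δ_…_neg'`, `bsdp_two_…_of_creutzMiller` of cell
bsd-2adic's `…TowerClass…` and att-p4 g22's `…TwistFamilySmallSeeds`), `hμan`-free. The rank row of `1727a1` at the rung `0` is g25's
`…CubicRankDoorModelsRungZero.mazurMainConjecture_two_1727a1_of_classGroup_layerZeroOne_models` (p758570) and is not repeated.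

THE TABLE (2-division cubic `4x³ + b₂x² + 2b₄x + b₆` of Cremona's minimal model; `β` any root; `L'` ANY quadratic extension of `ℚ(β)` containing `θ` with `θ² = 2`):
* `1727a1` `[1,−1,0,−76,275]`: `4x³ − 3x² − 304x + 1100`, `Δ_min = −1727` — class-number row (rank row: p758570);
* `2071a1` `[1,−1,0,19,−32]`: `4x³ − 3x² + 76x − 128`, `Δ_min = −747631` — rank and class-number rows;
* `4087a1` `[1,0,0,−37497,−2922032]`: `4x³ + x² − 149988x − 11688128`, `Δ_min = −306452746911967` — rank and class-number rows;
* `4087c1` `[1,1,0,−4,3]`: `4x³ + 5x² − 16x + 12`, `Δ_min = −4087` — rank and class-number rows (`ℚ(β)` is the SAME cubic field as for `4087a1`: one computation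
  serves both rows);
* `2045b1`: p761162 §4.
All five have `Δ_min ≡ 1 (mod 8)` except `2045b1` (`≡ 3`); the doors used need no stratum binder. DATA ASK (-data): `bnfinit` of each cubic and of its `√2`-extension
(2-rank of `Cl`, or just the 2-part of `h`). An equality fires the row (MC₂ of the seed mod PRINT⁵ + CM + MuIneqʳ); a GROWING sequence of 2-ranks up the tower is the
falsifier shape (p757971 §4).

PARTITION (D-0171): none moved. Beyond-print theorem: no. BSD is NOT proved.

References: [Fukuda1994] Thm. 1 (1)(2), p. 264; [Washington1997] §13.1; [CreutzMiller2012] Thm. 1.1; [Kato2004Asterisque] Thm. 17.4 (1)(2) (p. 273);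
[GreenbergLNM1716] Thm. 4.1 (p. 102), Conj. 1.11 (p. 58); [CremonaAlgorithms1997] Table 1 (`1727a1`, `2071a1`, `4087a1`, `4087c1`).
-/

set_option linter.dupNamespace false
set_option autoImplicit false

noncomputable section

open scoped MatrixGroups ModularForm NumberField Classical
open CongruenceSubgroup WeierstrassCurve Polynomial NumberField Module Field
open Literature.NumberTheory.EllipticCurves Literature.NumberTheory.EllipticCurves.ModularForms
open Literature.NumberTheory.EllipticCurves.Greenberg1999 Literature.NumberTheory.EllipticCurves.Module
open Literature.NumberTheory.EllipticCurves.Rank1Residual Literature.NumberTheory.EllipticCurves.Rank1Residual.Typed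
open Literature.NumberTheory.GaloisRepresentations Literature.NumberTheory.IwasawaTheory
open Summit.BirchSwinnertonDyer.Rank1Residual Summit.BirchSwinnertonDyer.Rank1Residual.F1Sign2
open Summit.BirchSwinnertonDyer.Rank1Residual.X1.MuLambda Summit.BirchSwinnertonDyer.Rank1Residual.X5
open Summit.BirchSwinnertonDyer.BirchSwinnertonDyer.Theorems.Rank1ResidualX1Defs
open Summit.BirchSwinnertonDyer.BirchSwinnertonDyer.Theses.AlignedTransportAtTwo
open Summit.BirchSwinnertonDyer.BirchSwinnertonDyer.Theorems.AlignedTransportAtTwoCubicRankDoorModelsAnyRung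
  (mazurMainConjecture_two_of_muIneqRel_of_classGroup_rungZero_models mazurMainConjecture_two_of_muIneqRel_of_classNumber_rungZero_models)
open Summit.BirchSwinnertonDyer.BirchSwinnertonDyer.Theorems.TowerClass
open Summit.BirchSwinnertonDyer.BirchSwinnertonDyer.Theorems.AlignedTransportAtTwoTwistFamilySmallSeeds

namespace Summit.BirchSwinnertonDyer.BirchSwinnertonDyer.Theorems.AlignedTransportAtTwoCubicRankDoorModelsRungZeroRows

/-! ## Row `1727a1` -/

/-- **ROW `1727a1` AT THE RUNG `0` ON MODELS, CLASS-NUMBER currency** (`[1,−1,0,−76,275]`, 2-division cubic `4x³ − 3x² − 304x + 1100`, `Δ_min = −1727 ≡ 1 (mod 8) (Kilford stratum)`, `N = 1727 < 5000`): PRINT⁵ + Creutz–Miller + MuIneqʳ (verbatim) + displayed {`r_an(1727a1) = 0`; ONE quadratic extension `L' ⊇ ℚ(β)` with `θ² = 2` and **`ord₂ #Cl(L') = ord₂ #Cl(ℚ(β))`**}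
⟹ `MC₂(1727a1)`, `hμan`-free. DATA ASK (-data): the 2-parts of `h(ℚ(β))` and `h(ℚ(β, √2))`. CONDITIONAL; BSD is NOT proved. [cite: Fukuda1994, Thm. 1 (1), p. 264]
[cite: CreutzMiller2012, Thm. 1.1] [cite: Kato2004Asterisque, Thm. 17.4 (1)(2) (p. 273)] [cite: CremonaAlgorithms1997, Table 1] -/
theorem mazurMainConjecture_two_1727a1_of_classNumber_rungZero_models
    (h17 : ∀ [NeZero (c1727a1.conductorNorm ℤ)] (f : CuspForm (Gamma0 (c1727a1.conductorNorm ℤ)) 2),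
      kato_divisibility_allPrimes c1727a1 2 (f := f))
    (hGr : Greenberg1999.thm41_charValue_rankZero_anyPrime)
    (hper : realPeriodRat_eq_unit_mul_plusPeriod_two) (hmod : nonempty_modularParametrizationData)
    (hGZK : rank_eq_analyticRank_of_analyticRank_le_one) (hCM : bsdTriple_of_rank_le_one_of_conductor_lt)
    (hI : ∀ (W : WeierstrassCurve ℚ) [W.IsElliptic] [W.IsGloballyMinimal], IsOrdinaryAt W 2 →
      (∀ x : ℚ, ¬ HasRationalTwoTorsionX W x) →
      ∀ (κ : ZpExtension ℚ 2) (γ : Field.absoluteGaloisGroup ℚ), κ.IsCyclotomic →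
      κ.IsTopGenerator γ → IsCyclotomicVariable 2 γ →
      ∀ ⦃N : ℕ⦄ [NeZero N] (f : CuspForm (Gamma0 N) 2), IsNewformOf W f →
      ∀ Gp : IwasawaAlgebra 2, iwasawaToPowerSeries 2 Gp = padicLFunction f (unitRoot W 2 : ℚ_[2]) →
      ∀ (D : W.SelmerDualData κ γ) (Yr : W.FineSelmerDualDataRelaxedInf κ γ),
        lengthAt (IwasawaAlgebra 2) D.X ⟨IwasawaAlgebra.augIdealP 2, IwasawaAlgebra.isPrime_augIdealP_holds 2⟩ ≤
          lengthAt (IwasawaAlgebra 2) (IwasawaAlgebra 2 ⧸ Ideal.span {Gp})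
              ⟨IwasawaAlgebra.augIdealP 2, IwasawaAlgebra.isPrime_augIdealP_holds 2⟩ +
            lengthAt (IwasawaAlgebra 2) Yr.X ⟨IwasawaAlgebra.augIdealP 2, IwasawaAlgebra.isPrime_augIdealP_holds 2⟩)
    (hr0 : c1727a1.analyticRank = 0)
    {β : AlgebraicClosure ℚ} (hβ : aeval β c1727a1.twoTorsionPolynomial.toPoly = 0)
    (L' : Type) [Field L'] [NumberField L'] [Algebra ↥(IntermediateField.adjoin ℚ ({β} : Set (AlgebraicClosure ℚ))) L']
    (hL' : Module.finrank ↥(IntermediateField.adjoin ℚ ({β} : Set (AlgebraicClosure ℚ))) L' = 2) (θ : L') (hθ : θ ^ 2 = 2)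
    (hclass : padicValNat 2 (Nat.card (ClassGroup (𝓞 L'))) =
      padicValNat 2 (Nat.card (ClassGroup (𝓞 ↥(IntermediateField.adjoin ℚ ({β} : Set (AlgebraicClosure ℚ))))))) :
    MazurMainConjecture c1727a1 2 :=
  mazurMainConjecture_two_of_muIneqRel_of_classNumber_rungZero_models c1727a1 h17 hGr hper hmod hGZK hI goodOrd_two_1727a1
    not_hasRationalTwoTorsionX_1727a1 Δ_1727a1_neg' hr0 (bsdp_two_1727a1_of_creutzMiller hCM hGZK hr0) hβ L' hL' θ hθ hclass

/-! ## Row `2071a1` -/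

/-- **ROW `2071a1` AT THE RUNG `0` ON MODELS, RANK currency** (`[1,−1,0,19,−32]`, 2-division cubic `4x³ − 3x² + 76x − 128`, `Δ_min = −747631 ≡ 1 (mod 8) (Kilford stratum)`, `N = 2071 = 19·109 < 5000`): PRINT⁵ + Creutz–Miller + MuIneqʳ (verbatim) + displayed {`r_an(2071a1) = 0`; ONE quadratic extension `L' ⊇ ℚ(β)` with `θ² = 2` and **`rank₂ Cl(L') = rank₂ Cl(ℚ(β))`**}
⟹ `MC₂(2071a1)`, `hμan`-free. DATA ASK (-data): `rank₂ Cl(ℚ(β))` vs `rank₂ Cl(ℚ(β, √2))`. CONDITIONAL; BSD is NOT proved. [cite: Fukuda1994, Thm. 1 (2), p. 264]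
[cite: CreutzMiller2012, Thm. 1.1] [cite: Kato2004Asterisque, Thm. 17.4 (1)(2) (p. 273)] [cite: CremonaAlgorithms1997, Table 1] -/
theorem mazurMainConjecture_two_2071a1_of_classGroup_rungZero_models
    (h17 : ∀ [NeZero (c2071a1.conductorNorm ℤ)] (f : CuspForm (Gamma0 (c2071a1.conductorNorm ℤ)) 2),
      kato_divisibility_allPrimes c2071a1 2 (f := f))
    (hGr : Greenberg1999.thm41_charValue_rankZero_anyPrime)
    (hper : realPeriodRat_eq_unit_mul_plusPeriod_two) (hmod : nonempty_modularParametrizationData)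
    (hGZK : rank_eq_analyticRank_of_analyticRank_le_one) (hCM : bsdTriple_of_rank_le_one_of_conductor_lt)
    (hI : ∀ (W : WeierstrassCurve ℚ) [W.IsElliptic] [W.IsGloballyMinimal], IsOrdinaryAt W 2 →
      (∀ x : ℚ, ¬ HasRationalTwoTorsionX W x) →
      ∀ (κ : ZpExtension ℚ 2) (γ : Field.absoluteGaloisGroup ℚ), κ.IsCyclotomic →
      κ.IsTopGenerator γ → IsCyclotomicVariable 2 γ →
      ∀ ⦃N : ℕ⦄ [NeZero N] (f : CuspForm (Gamma0 N) 2), IsNewformOf W f →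
      ∀ Gp : IwasawaAlgebra 2, iwasawaToPowerSeries 2 Gp = padicLFunction f (unitRoot W 2 : ℚ_[2]) →
      ∀ (D : W.SelmerDualData κ γ) (Yr : W.FineSelmerDualDataRelaxedInf κ γ),
        lengthAt (IwasawaAlgebra 2) D.X ⟨IwasawaAlgebra.augIdealP 2, IwasawaAlgebra.isPrime_augIdealP_holds 2⟩ ≤
          lengthAt (IwasawaAlgebra 2) (IwasawaAlgebra 2 ⧸ Ideal.span {Gp})
              ⟨IwasawaAlgebra.augIdealP 2, IwasawaAlgebra.isPrime_augIdealP_holds 2⟩ +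
            lengthAt (IwasawaAlgebra 2) Yr.X ⟨IwasawaAlgebra.augIdealP 2, IwasawaAlgebra.isPrime_augIdealP_holds 2⟩)
    (hr0 : c2071a1.analyticRank = 0)
    {β : AlgebraicClosure ℚ} (hβ : aeval β c2071a1.twoTorsionPolynomial.toPoly = 0)
    (L' : Type) [Field L'] [NumberField L'] [Algebra ↥(IntermediateField.adjoin ℚ ({β} : Set (AlgebraicClosure ℚ))) L']
    (hL' : Module.finrank ↥(IntermediateField.adjoin ℚ ({β} : Set (AlgebraicClosure ℚ))) L' = 2) (θ : L') (hθ : θ ^ 2 = 2)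
    (hrank : padicValNat 2 (Nat.card (ClassGroup (𝓞 L') ⧸ (powMonoidHom 2 : ClassGroup (𝓞 L') →* ClassGroup (𝓞 L')).range)) =
      padicValNat 2 (Nat.card (ClassGroup (𝓞 ↥(IntermediateField.adjoin ℚ ({β} : Set (AlgebraicClosure ℚ)))) ⧸
        (powMonoidHom 2 : ClassGroup (𝓞 ↥(IntermediateField.adjoin ℚ ({β} : Set (AlgebraicClosure ℚ)))) →*
          ClassGroup (𝓞 ↥(IntermediateField.adjoin ℚ ({β} : Set (AlgebraicClosure ℚ))))).range))) :
    MazurMainConjecture c2071a1 2 :=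
  mazurMainConjecture_two_of_muIneqRel_of_classGroup_rungZero_models c2071a1 h17 hGr hper hmod hGZK hI goodOrd_two_2071a1
    not_hasRationalTwoTorsionX_2071a1 Δ_2071a1_neg' hr0 (bsdp_two_2071a1_of_creutzMiller hCM hGZK hr0) hβ L' hL' θ hθ hrank

/-- **ROW `2071a1` AT THE RUNG `0` ON MODELS, CLASS-NUMBER currency** (`[1,−1,0,19,−32]`, 2-division cubic `4x³ − 3x² + 76x − 128`, `Δ_min = −747631 ≡ 1 (mod 8) (Kilford stratum)`, `N = 2071 = 19·109 < 5000`): PRINT⁵ + Creutz–Miller + MuIneqʳ (verbatim) + displayed {`r_an(2071a1) = 0`; ONE quadratic extension `L' ⊇ ℚ(β)` with `θ² = 2` and **`ord₂ #Cl(L') = ord₂ #Cl(ℚ(β))`**}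
⟹ `MC₂(2071a1)`, `hμan`-free. DATA ASK (-data): the 2-parts of `h(ℚ(β))` and `h(ℚ(β, √2))`. CONDITIONAL; BSD is NOT proved. [cite: Fukuda1994, Thm. 1 (1), p. 264]
[cite: CreutzMiller2012, Thm. 1.1] [cite: Kato2004Asterisque, Thm. 17.4 (1)(2) (p. 273)] [cite: CremonaAlgorithms1997, Table 1] -/
theorem mazurMainConjecture_two_2071a1_of_classNumber_rungZero_models
    (h17 : ∀ [NeZero (c2071a1.conductorNorm ℤ)] (f : CuspForm (Gamma0 (c2071a1.conductorNorm ℤ)) 2),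
      kato_divisibility_allPrimes c2071a1 2 (f := f))
    (hGr : Greenberg1999.thm41_charValue_rankZero_anyPrime)
    (hper : realPeriodRat_eq_unit_mul_plusPeriod_two) (hmod : nonempty_modularParametrizationData)
    (hGZK : rank_eq_analyticRank_of_analyticRank_le_one) (hCM : bsdTriple_of_rank_le_one_of_conductor_lt)
    (hI : ∀ (W : WeierstrassCurve ℚ) [W.IsElliptic] [W.IsGloballyMinimal], IsOrdinaryAt W 2 →
      (∀ x : ℚ, ¬ HasRationalTwoTorsionX W x) →
      ∀ (κ : ZpExtension ℚ 2) (γ : Field.absoluteGaloisGroup ℚ), κ.IsCyclotomic →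
      κ.IsTopGenerator γ → IsCyclotomicVariable 2 γ →
      ∀ ⦃N : ℕ⦄ [NeZero N] (f : CuspForm (Gamma0 N) 2), IsNewformOf W f →
      ∀ Gp : IwasawaAlgebra 2, iwasawaToPowerSeries 2 Gp = padicLFunction f (unitRoot W 2 : ℚ_[2]) →
      ∀ (D : W.SelmerDualData κ γ) (Yr : W.FineSelmerDualDataRelaxedInf κ γ),
        lengthAt (IwasawaAlgebra 2) D.X ⟨IwasawaAlgebra.augIdealP 2, IwasawaAlgebra.isPrime_augIdealP_holds 2⟩ ≤
          lengthAt (IwasawaAlgebra 2) (IwasawaAlgebra 2 ⧸ Ideal.span {Gp})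
              ⟨IwasawaAlgebra.augIdealP 2, IwasawaAlgebra.isPrime_augIdealP_holds 2⟩ +
            lengthAt (IwasawaAlgebra 2) Yr.X ⟨IwasawaAlgebra.augIdealP 2, IwasawaAlgebra.isPrime_augIdealP_holds 2⟩)
    (hr0 : c2071a1.analyticRank = 0)
    {β : AlgebraicClosure ℚ} (hβ : aeval β c2071a1.twoTorsionPolynomial.toPoly = 0)
    (L' : Type) [Field L'] [NumberField L'] [Algebra ↥(IntermediateField.adjoin ℚ ({β} : Set (AlgebraicClosure ℚ))) L']
    (hL' : Module.finrank ↥(IntermediateField.adjoin ℚ ({β} : Set (AlgebraicClosure ℚ))) L' = 2) (θ : L') (hθ : θ ^ 2 = 2)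
    (hclass : padicValNat 2 (Nat.card (ClassGroup (𝓞 L'))) =
      padicValNat 2 (Nat.card (ClassGroup (𝓞 ↥(IntermediateField.adjoin ℚ ({β} : Set (AlgebraicClosure ℚ))))))) :
    MazurMainConjecture c2071a1 2 :=
  mazurMainConjecture_two_of_muIneqRel_of_classNumber_rungZero_models c2071a1 h17 hGr hper hmod hGZK hI goodOrd_two_2071a1
    not_hasRationalTwoTorsionX_2071a1 Δ_2071a1_neg' hr0 (bsdp_two_2071a1_of_creutzMiller hCM hGZK hr0) hβ L' hL' θ hθ hclass

/-! ## Row `4087a1` -/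

/-- **ROW `4087a1` AT THE RUNG `0` ON MODELS, RANK currency** (`[1,0,0,−37497,−2922032]`, 2-division cubic `4x³ + x² − 149988x − 11688128`, `Δ_min = −306452746911967 ≡ 1 (mod 8) (Kilford stratum; the SAME cubic field as `4087c1`, att-p4 g25)`, `N = 4087 = 61·67 < 5000`): PRINT⁵ + Creutz–Miller + MuIneqʳ (verbatim) + displayed {`r_an(4087a1) = 0`; ONE quadratic extension `L' ⊇ ℚ(β)` with `θ² = 2` and **`rank₂ Cl(L') = rank₂ Cl(ℚ(β))`**}
⟹ `MC₂(4087a1)`, `hμan`-free. DATA ASK (-data): `rank₂ Cl(ℚ(β))` vs `rank₂ Cl(ℚ(β, √2))`. CONDITIONAL; BSD is NOT proved. [cite: Fukuda1994, Thm. 1 (2), p. 264]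
[cite: CreutzMiller2012, Thm. 1.1] [cite: Kato2004Asterisque, Thm. 17.4 (1)(2) (p. 273)] [cite: CremonaAlgorithms1997, Table 1] -/
theorem mazurMainConjecture_two_4087a1_of_classGroup_rungZero_models
    (h17 : ∀ [NeZero (c4087a1.conductorNorm ℤ)] (f : CuspForm (Gamma0 (c4087a1.conductorNorm ℤ)) 2),
      kato_divisibility_allPrimes c4087a1 2 (f := f))
    (hGr : Greenberg1999.thm41_charValue_rankZero_anyPrime)
    (hper : realPeriodRat_eq_unit_mul_plusPeriod_two) (hmod : nonempty_modularParametrizationData)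
    (hGZK : rank_eq_analyticRank_of_analyticRank_le_one) (hCM : bsdTriple_of_rank_le_one_of_conductor_lt)
    (hI : ∀ (W : WeierstrassCurve ℚ) [W.IsElliptic] [W.IsGloballyMinimal], IsOrdinaryAt W 2 →
      (∀ x : ℚ, ¬ HasRationalTwoTorsionX W x) →
      ∀ (κ : ZpExtension ℚ 2) (γ : Field.absoluteGaloisGroup ℚ), κ.IsCyclotomic →
      κ.IsTopGenerator γ → IsCyclotomicVariable 2 γ →
      ∀ ⦃N : ℕ⦄ [NeZero N] (f : CuspForm (Gamma0 N) 2), IsNewformOf W f →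
      ∀ Gp : IwasawaAlgebra 2, iwasawaToPowerSeries 2 Gp = padicLFunction f (unitRoot W 2 : ℚ_[2]) →
      ∀ (D : W.SelmerDualData κ γ) (Yr : W.FineSelmerDualDataRelaxedInf κ γ),
        lengthAt (IwasawaAlgebra 2) D.X ⟨IwasawaAlgebra.augIdealP 2, IwasawaAlgebra.isPrime_augIdealP_holds 2⟩ ≤
          lengthAt (IwasawaAlgebra 2) (IwasawaAlgebra 2 ⧸ Ideal.span {Gp})
              ⟨IwasawaAlgebra.augIdealP 2, IwasawaAlgebra.isPrime_augIdealP_holds 2⟩ +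
            lengthAt (IwasawaAlgebra 2) Yr.X ⟨IwasawaAlgebra.augIdealP 2, IwasawaAlgebra.isPrime_augIdealP_holds 2⟩)
    (hr0 : c4087a1.analyticRank = 0)
    {β : AlgebraicClosure ℚ} (hβ : aeval β c4087a1.twoTorsionPolynomial.toPoly = 0)
    (L' : Type) [Field L'] [NumberField L'] [Algebra ↥(IntermediateField.adjoin ℚ ({β} : Set (AlgebraicClosure ℚ))) L']
    (hL' : Module.finrank ↥(IntermediateField.adjoin ℚ ({β} : Set (AlgebraicClosure ℚ))) L' = 2) (θ : L') (hθ : θ ^ 2 = 2)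
    (hrank : padicValNat 2 (Nat.card (ClassGroup (𝓞 L') ⧸ (powMonoidHom 2 : ClassGroup (𝓞 L') →* ClassGroup (𝓞 L')).range)) =
      padicValNat 2 (Nat.card (ClassGroup (𝓞 ↥(IntermediateField.adjoin ℚ ({β} : Set (AlgebraicClosure ℚ)))) ⧸
        (powMonoidHom 2 : ClassGroup (𝓞 ↥(IntermediateField.adjoin ℚ ({β} : Set (AlgebraicClosure ℚ)))) →*
          ClassGroup (𝓞 ↥(IntermediateField.adjoin ℚ ({β} : Set (AlgebraicClosure ℚ))))).range))) :
    MazurMainConjecture c4087a1 2 :=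
  mazurMainConjecture_two_of_muIneqRel_of_classGroup_rungZero_models c4087a1 h17 hGr hper hmod hGZK hI goodOrd_two_4087a1
    not_hasRationalTwoTorsionX_4087a1 Δ_4087a1_neg' hr0 (bsdp_two_4087a1_of_creutzMiller hCM hGZK hr0) hβ L' hL' θ hθ hrank

/-- **ROW `4087a1` AT THE RUNG `0` ON MODELS, CLASS-NUMBER currency** (`[1,0,0,−37497,−2922032]`, 2-division cubic `4x³ + x² − 149988x − 11688128`, `Δ_min = −306452746911967 ≡ 1 (mod 8) (Kilford stratum; the SAME cubic field as `4087c1`, att-p4 g25)`, `N = 4087 = 61·67 < 5000`): PRINT⁵ + Creutz–Miller + MuIneqʳ (verbatim) + displayed {`r_an(4087a1) = 0`; ONE quadratic extension `L' ⊇ ℚ(β)` with `θ² = 2` and **`ord₂ #Cl(L') = ord₂ #Cl(ℚ(β))`**}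
⟹ `MC₂(4087a1)`, `hμan`-free. DATA ASK (-data): the 2-parts of `h(ℚ(β))` and `h(ℚ(β, √2))`. CONDITIONAL; BSD is NOT proved. [cite: Fukuda1994, Thm. 1 (1), p. 264]
[cite: CreutzMiller2012, Thm. 1.1] [cite: Kato2004Asterisque, Thm. 17.4 (1)(2) (p. 273)] [cite: CremonaAlgorithms1997, Table 1] -/
theorem mazurMainConjecture_two_4087a1_of_classNumber_rungZero_models
    (h17 : ∀ [NeZero (c4087a1.conductorNorm ℤ)] (f : CuspForm (Gamma0 (c4087a1.conductorNorm ℤ)) 2),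
      kato_divisibility_allPrimes c4087a1 2 (f := f))
    (hGr : Greenberg1999.thm41_charValue_rankZero_anyPrime)
    (hper : realPeriodRat_eq_unit_mul_plusPeriod_two) (hmod : nonempty_modularParametrizationData)
    (hGZK : rank_eq_analyticRank_of_analyticRank_le_one) (hCM : bsdTriple_of_rank_le_one_of_conductor_lt)
    (hI : ∀ (W : WeierstrassCurve ℚ) [W.IsElliptic] [W.IsGloballyMinimal], IsOrdinaryAt W 2 →
      (∀ x : ℚ, ¬ HasRationalTwoTorsionX W x) →
      ∀ (κ : ZpExtension ℚ 2) (γ : Field.absoluteGaloisGroup ℚ), κ.IsCyclotomic →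
      κ.IsTopGenerator γ → IsCyclotomicVariable 2 γ →
      ∀ ⦃N : ℕ⦄ [NeZero N] (f : CuspForm (Gamma0 N) 2), IsNewformOf W f →
      ∀ Gp : IwasawaAlgebra 2, iwasawaToPowerSeries 2 Gp = padicLFunction f (unitRoot W 2 : ℚ_[2]) →
      ∀ (D : W.SelmerDualData κ γ) (Yr : W.FineSelmerDualDataRelaxedInf κ γ),
        lengthAt (IwasawaAlgebra 2) D.X ⟨IwasawaAlgebra.augIdealP 2, IwasawaAlgebra.isPrime_augIdealP_holds 2⟩ ≤
          lengthAt (IwasawaAlgebra 2) (IwasawaAlgebra 2 ⧸ Ideal.span {Gp})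
              ⟨IwasawaAlgebra.augIdealP 2, IwasawaAlgebra.isPrime_augIdealP_holds 2⟩ +
            lengthAt (IwasawaAlgebra 2) Yr.X ⟨IwasawaAlgebra.augIdealP 2, IwasawaAlgebra.isPrime_augIdealP_holds 2⟩)
    (hr0 : c4087a1.analyticRank = 0)
    {β : AlgebraicClosure ℚ} (hβ : aeval β c4087a1.twoTorsionPolynomial.toPoly = 0)
    (L' : Type) [Field L'] [NumberField L'] [Algebra ↥(IntermediateField.adjoin ℚ ({β} : Set (AlgebraicClosure ℚ))) L']
    (hL' : Module.finrank ↥(IntermediateField.adjoin ℚ ({β} : Set (AlgebraicClosure ℚ))) L' = 2) (θ : L') (hθ : θ ^ 2 = 2)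
    (hclass : padicValNat 2 (Nat.card (ClassGroup (𝓞 L'))) =
      padicValNat 2 (Nat.card (ClassGroup (𝓞 ↥(IntermediateField.adjoin ℚ ({β} : Set (AlgebraicClosure ℚ))))))) :
    MazurMainConjecture c4087a1 2 :=
  mazurMainConjecture_two_of_muIneqRel_of_classNumber_rungZero_models c4087a1 h17 hGr hper hmod hGZK hI goodOrd_two_4087a1
    not_hasRationalTwoTorsionX_4087a1 Δ_4087a1_neg' hr0 (bsdp_two_4087a1_of_creutzMiller hCM hGZK hr0) hβ L' hL' θ hθ hclass

/-! ## Row `4087c1` -/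

/-- **ROW `4087c1` AT THE RUNG `0` ON MODELS, RANK currency** (`[1,1,0,−4,3]`, 2-division cubic `4x³ + 5x² − 16x + 12`, `Δ_min = −4087 ≡ 1 (mod 8) (Kilford stratum; the SAME cubic field as `4087a1`)`, `N = 4087 = 61·67 < 5000`): PRINT⁵ + Creutz–Miller + MuIneqʳ (verbatim) + displayed {`r_an(4087c1) = 0`; ONE quadratic extension `L' ⊇ ℚ(β)` with `θ² = 2` and **`rank₂ Cl(L') = rank₂ Cl(ℚ(β))`**}
⟹ `MC₂(4087c1)`, `hμan`-free. DATA ASK (-data): `rank₂ Cl(ℚ(β))` vs `rank₂ Cl(ℚ(β, √2))`. CONDITIONAL; BSD is NOT proved. [cite: Fukuda1994, Thm. 1 (2), p. 264]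
[cite: CreutzMiller2012, Thm. 1.1] [cite: Kato2004Asterisque, Thm. 17.4 (1)(2) (p. 273)] [cite: CremonaAlgorithms1997, Table 1] -/
theorem mazurMainConjecture_two_4087c1_of_classGroup_rungZero_models
    (h17 : ∀ [NeZero (c4087c1.conductorNorm ℤ)] (f : CuspForm (Gamma0 (c4087c1.conductorNorm ℤ)) 2),
      kato_divisibility_allPrimes c4087c1 2 (f := f))
    (hGr : Greenberg1999.thm41_charValue_rankZero_anyPrime)
    (hper : realPeriodRat_eq_unit_mul_plusPeriod_two) (hmod : nonempty_modularParametrizationData)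
    (hGZK : rank_eq_analyticRank_of_analyticRank_le_one) (hCM : bsdTriple_of_rank_le_one_of_conductor_lt)
    (hI : ∀ (W : WeierstrassCurve ℚ) [W.IsElliptic] [W.IsGloballyMinimal], IsOrdinaryAt W 2 →
      (∀ x : ℚ, ¬ HasRationalTwoTorsionX W x) →
      ∀ (κ : ZpExtension ℚ 2) (γ : Field.absoluteGaloisGroup ℚ), κ.IsCyclotomic →
      κ.IsTopGenerator γ → IsCyclotomicVariable 2 γ →
      ∀ ⦃N : ℕ⦄ [NeZero N] (f : CuspForm (Gamma0 N) 2), IsNewformOf W f →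
      ∀ Gp : IwasawaAlgebra 2, iwasawaToPowerSeries 2 Gp = padicLFunction f (unitRoot W 2 : ℚ_[2]) →
      ∀ (D : W.SelmerDualData κ γ) (Yr : W.FineSelmerDualDataRelaxedInf κ γ),
        lengthAt (IwasawaAlgebra 2) D.X ⟨IwasawaAlgebra.augIdealP 2, IwasawaAlgebra.isPrime_augIdealP_holds 2⟩ ≤
          lengthAt (IwasawaAlgebra 2) (IwasawaAlgebra 2 ⧸ Ideal.span {Gp})
              ⟨IwasawaAlgebra.augIdealP 2, IwasawaAlgebra.isPrime_augIdealP_holds 2⟩ +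
            lengthAt (IwasawaAlgebra 2) Yr.X ⟨IwasawaAlgebra.augIdealP 2, IwasawaAlgebra.isPrime_augIdealP_holds 2⟩)
    (hr0 : c4087c1.analyticRank = 0)
    {β : AlgebraicClosure ℚ} (hβ : aeval β c4087c1.twoTorsionPolynomial.toPoly = 0)
    (L' : Type) [Field L'] [NumberField L'] [Algebra ↥(IntermediateField.adjoin ℚ ({β} : Set (AlgebraicClosure ℚ))) L']
    (hL' : Module.finrank ↥(IntermediateField.adjoin ℚ ({β} : Set (AlgebraicClosure ℚ))) L' = 2) (θ : L') (hθ : θ ^ 2 = 2)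
    (hrank : padicValNat 2 (Nat.card (ClassGroup (𝓞 L') ⧸ (powMonoidHom 2 : ClassGroup (𝓞 L') →* ClassGroup (𝓞 L')).range)) =
      padicValNat 2 (Nat.card (ClassGroup (𝓞 ↥(IntermediateField.adjoin ℚ ({β} : Set (AlgebraicClosure ℚ)))) ⧸
        (powMonoidHom 2 : ClassGroup (𝓞 ↥(IntermediateField.adjoin ℚ ({β} : Set (AlgebraicClosure ℚ)))) →*
          ClassGroup (𝓞 ↥(IntermediateField.adjoin ℚ ({β} : Set (AlgebraicClosure ℚ))))).range))) :
    MazurMainConjecture c4087c1 2 :=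
  mazurMainConjecture_two_of_muIneqRel_of_classGroup_rungZero_models c4087c1 h17 hGr hper hmod hGZK hI goodOrd_two_4087c1
    not_hasRationalTwoTorsionX_4087c1 Δ_4087c1_neg' hr0 (bsdp_two_4087c1_of_creutzMiller hCM hGZK hr0) hβ L' hL' θ hθ hrank

/-- **ROW `4087c1` AT THE RUNG `0` ON MODELS, CLASS-NUMBER currency** (`[1,1,0,−4,3]`, 2-division cubic `4x³ + 5x² − 16x + 12`, `Δ_min = −4087 ≡ 1 (mod 8) (Kilford stratum; the SAME cubic field as `4087a1`)`, `N = 4087 = 61·67 < 5000`): PRINT⁵ + Creutz–Miller + MuIneqʳ (verbatim) + displayed {`r_an(4087c1) = 0`; ONE quadratic extension `L' ⊇ ℚ(β)` with `θ² = 2` and **`ord₂ #Cl(L') = ord₂ #Cl(ℚ(β))`**}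
⟹ `MC₂(4087c1)`, `hμan`-free. DATA ASK (-data): the 2-parts of `h(ℚ(β))` and `h(ℚ(β, √2))`. CONDITIONAL; BSD is NOT proved. [cite: Fukuda1994, Thm. 1 (1), p. 264]
[cite: CreutzMiller2012, Thm. 1.1] [cite: Kato2004Asterisque, Thm. 17.4 (1)(2) (p. 273)] [cite: CremonaAlgorithms1997, Table 1] -/
theorem mazurMainConjecture_two_4087c1_of_classNumber_rungZero_models
    (h17 : ∀ [NeZero (c4087c1.conductorNorm ℤ)] (f : CuspForm (Gamma0 (c4087c1.conductorNorm ℤ)) 2),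
      kato_divisibility_allPrimes c4087c1 2 (f := f))
    (hGr : Greenberg1999.thm41_charValue_rankZero_anyPrime)
    (hper : realPeriodRat_eq_unit_mul_plusPeriod_two) (hmod : nonempty_modularParametrizationData)
    (hGZK : rank_eq_analyticRank_of_analyticRank_le_one) (hCM : bsdTriple_of_rank_le_one_of_conductor_lt)
    (hI : ∀ (W : WeierstrassCurve ℚ) [W.IsElliptic] [W.IsGloballyMinimal], IsOrdinaryAt W 2 →
      (∀ x : ℚ, ¬ HasRationalTwoTorsionX W x) →
      ∀ (κ : ZpExtension ℚ 2) (γ : Field.absoluteGaloisGroup ℚ), κ.IsCyclotomic →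
      κ.IsTopGenerator γ → IsCyclotomicVariable 2 γ →
      ∀ ⦃N : ℕ⦄ [NeZero N] (f : CuspForm (Gamma0 N) 2), IsNewformOf W f →
      ∀ Gp : IwasawaAlgebra 2, iwasawaToPowerSeries 2 Gp = padicLFunction f (unitRoot W 2 : ℚ_[2]) →
      ∀ (D : W.SelmerDualData κ γ) (Yr : W.FineSelmerDualDataRelaxedInf κ γ),
        lengthAt (IwasawaAlgebra 2) D.X ⟨IwasawaAlgebra.augIdealP 2, IwasawaAlgebra.isPrime_augIdealP_holds 2⟩ ≤
          lengthAt (IwasawaAlgebra 2) (IwasawaAlgebra 2 ⧸ Ideal.span {Gp})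
              ⟨IwasawaAlgebra.augIdealP 2, IwasawaAlgebra.isPrime_augIdealP_holds 2⟩ +
            lengthAt (IwasawaAlgebra 2) Yr.X ⟨IwasawaAlgebra.augIdealP 2, IwasawaAlgebra.isPrime_augIdealP_holds 2⟩)
    (hr0 : c4087c1.analyticRank = 0)
    {β : AlgebraicClosure ℚ} (hβ : aeval β c4087c1.twoTorsionPolynomial.toPoly = 0)
    (L' : Type) [Field L'] [NumberField L'] [Algebra ↥(IntermediateField.adjoin ℚ ({β} : Set (AlgebraicClosure ℚ))) L']
    (hL' : Module.finrank ↥(IntermediateField.adjoin ℚ ({β} : Set (AlgebraicClosure ℚ))) L' = 2) (θ : L') (hθ : θ ^ 2 = 2)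
    (hclass : padicValNat 2 (Nat.card (ClassGroup (𝓞 L'))) =
      padicValNat 2 (Nat.card (ClassGroup (𝓞 ↥(IntermediateField.adjoin ℚ ({β} : Set (AlgebraicClosure ℚ))))))) :
    MazurMainConjecture c4087c1 2 :=
  mazurMainConjecture_two_of_muIneqRel_of_classNumber_rungZero_models c4087c1 h17 hGr hper hmod hGZK hI goodOrd_two_4087c1
    not_hasRationalTwoTorsionX_4087c1 Δ_4087c1_neg' hr0 (bsdp_two_4087c1_of_creutzMiller hCM hGZK hr0) hβ L' hL' θ hθ hclass

end Summit.BirchSwinnertonDyer.BirchSwinnertonDyer.Theorems.AlignedTransportAtTwoCubicRankDoorModelsRungZeroRows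

end
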